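import Mathlib
import HarnessLib
import Summits.NavierStokesRegularity.NavierStokesRegularity.Theorems.PoloidalWindowRigidity.Negative.TriWaveProfile
import Summits.NavierStokesRegularity.NavierStokesRegularity.Theorems.PoloidalWindowRigidity.Negative.AnyFrameDrift

/-!
# Crux `PoloidalWindowRigidity` (K2, stmt-NavierStokesRegularity-19708) — negative side:
# the three-wave profile is axisymmetric in no rigid frame

Negative-side support (refuter seat ns-regularity-refuter1 gen 2; D-0081 §C), sequel of `…Negative.TriWaveProfile` and
`…Negative.AnyFrameDrift` (whose frame argument is abstracted here):

* `not_axisymmetric_anyFrame_of_separated_level`: if a level set `{‖V‖² = M}` is `1`-separated and contains `P₀`,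
  `P₀ + 2π e₀`, `P₀ + 2π e₁`, then `z ↦ L⁻¹ V(L z + c)` is axisymmetric for no linear isometry `L` and centre `c`;
* `norm_sq_triField_le` (`|T|² ≤ 40`), `sin_eq_zero_of_norm_sq_triField_eq` (the maximum set lies in
  `{sin u = sin w = sin p = 0}`), `eq_of_norm_sq_triField_eq` (it is `1`-separated), and the three maximum points
  `(π/2,π/2,π/2) (+ 2π e₀, + 2π e₁)`;
* `triField_not_axisymmetric_anyFrame`, `triProfile_not_axisymmetric_anyFrame`: clause (11) of S2⁗ for the witness.

WHAT THIS IS NOT: not a claim about Navier–Stokes — kinematics of an explicit profile. [folklore]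
-/

noncomputable section

-- the summit and its single sub-problem share the name (CONVENTIONS §1), as in every Theorems file
set_option linter.dupNamespace false

namespace Summit.NavierStokesRegularity.NavierStokesRegularity.Theorems.PoloidalWindowRigidity.Negative

open MeasureTheory Set Function Filter Topology Metric
open scoped RealInnerProductSpace InnerProductSpace ENNReal NNReal
open Literature.Analysis Literature.Analysis.FluidPDE


/-! ## The three-wave field is axisymmetric in no rigid frame

The level set `{|T|² = 40}` (the maximum set of `|T|²`) is `{sin u = sin w = sin p = 0, cos w = −cos u = −cos p}`,
a lattice of isolated points; it contains `P₀ = (π/2, π/2, π/2)` and `P₀ + 2π e₀`, `P₀ + 2π e₁`.  The frame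
argument of `cellField_not_axisymmetric_anyFrame` is repeated for an abstract field with such a level set. -/

/-- **Frame lemma.** If a level set `{‖V‖² = M}` is `1`-separated and contains `P₀`, `P₀ + 2π e₀`, `P₀ + 2π e₁`,
then `z ↦ L⁻¹ V(L z + c)` is axisymmetric for no linear isometry `L` and no centre `c`: the level set is invariant
under the frame rotations, small rotations move points off the axis by less than `1`, so every point of the level
set lies on the axis `c + L(ℝ e₂)`, forcing `L⁻¹ e₀`, `L⁻¹ e₁` to be vertical — impossible for orthonormal vectors.
[folklore] -/
theorem not_axisymmetric_anyFrame_of_separated_level {V : EuclideanSpace ℝ (Fin 3) → EuclideanSpace ℝ (Fin 3)} {M :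
    ℝ} {P₀ : EuclideanSpace ℝ (Fin 3)}
    (hsep : ∀ x Q : EuclideanSpace ℝ (Fin 3), ‖V x‖ ^ 2 = M → ‖V Q‖ ^ 2 = M → dist x Q < 1 → x = Q) (hP₀ : ‖V P₀‖ ^ 2
        = M)
    (hP₁ : ‖V (P₀ + (2 * Real.pi) • (EuclideanSpace.single (0 : Fin 3) (1 : ℝ)))‖ ^ 2 = M) (hP₂ : ‖V (P₀ + (2 *
        Real.pi) • (EuclideanSpace.single (1 : Fin 3) (1 : ℝ)))‖ ^ 2 = M)
    (L : EuclideanSpace ℝ (Fin 3) ≃ₗᵢ[ℝ] EuclideanSpace ℝ (Fin 3)) (c : EuclideanSpace ℝ (Fin 3)) : ¬ IsAxisymmetric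
        (fun z => L.symm (V (L z + c))) := by
  intro hax
  -- ## `|V|` is invariant under the rotations of the frame
  have hnorm : ∀ (θ : ℝ) (z : EuclideanSpace ℝ (Fin 3)), ‖V (L (rotZ θ z) + c)‖ = ‖V (L z + c)‖ := by
    intro θ z
    have h := congrArg (fun w : EuclideanSpace ℝ (Fin 3) => ‖w‖) (hax θ z)
    simpa only [LinearIsometryEquiv.norm_map, norm_rotZ] using h
  -- ## every point of the level set lies on the axis of the frame
  have haxis : ∀ P : EuclideanSpace ℝ (Fin 3), ‖V P‖ ^ 2 = M → (L.symm (P - c)) 0 = 0 ∧ (L.symm (P - c)) 1 = 0 := by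
    intro P hP
    set z : EuclideanSpace ℝ (Fin 3) := L.symm (P - c) with hz
    have hzP : L z + c = P := by simp [hz]
    have hcont : Continuous fun θ : ℝ => L (rotZ θ z) + c :=
      (L.continuous.comp (continuous_rotZ_angle z)).add continuous_const
    obtain ⟨δ, hδ, hball⟩ := Metric.continuous_iff.1 hcont 0 1 one_pos
    set θ : ℝ := min (δ / 2) 1 with hθ
    have hθpos : 0 < θ := lt_min (by linarith) one_pos
    have hθδ : θ < δ := lt_of_le_of_lt (min_le_left _ _) (by linarith)
    have hθ1 : θ ≤ 1 := min_le_right _ _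
    have hcosθ : Real.cos θ ≠ 1 := by
      intro h1
      have h0 := (Real.cos_eq_one_iff_of_lt_of_lt (by linarith [Real.pi_gt_three])
        (by linarith [Real.pi_gt_three])).1 h1
      exact hθpos.ne' h0
    have hclose : dist (L (rotZ θ z) + c) P < 1 := by
      have h := hball θ (by rw [Real.dist_eq, sub_zero, abs_of_pos hθpos]; exact hθδ)
      rwa [rotZ_zero, hzP] at h
    have hmax : ‖V (L (rotZ θ z) + c)‖ ^ 2 = M := by rw [hnorm θ z, hzP, hP]
    have hEq : L (rotZ θ z) + c = P := hsep _ _ hmax hP hclose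
    have hfix : rotZ θ z = z := L.injective (add_right_cancel (hEq.trans hzP.symm))
    exact eq_zero_of_rotZ_eq_self hcosθ hfix
  obtain ⟨h00, h01⟩ := haxis _ hP₀
  obtain ⟨h10, h11⟩ := haxis _ hP₁
  obtain ⟨h20, h21⟩ := haxis _ hP₂
  -- ## hence `L⁻¹ e₀` and `L⁻¹ e₁` are vertical
  have hvert : ∀ j : Fin 3, (L.symm (P₀ + (2 * Real.pi) • EuclideanSpace.single j (1 : ℝ) - c)) 0 = 0 →
      (L.symm (P₀ + (2 * Real.pi) • EuclideanSpace.single j (1 : ℝ) - c)) 1 = 0 →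
      (L.symm (EuclideanSpace.single j (1 : ℝ))) 0 = 0 ∧ (L.symm (EuclideanSpace.single j (1 : ℝ))) 1 = 0 := by
    intro j hj0 hj1
    have hd : L.symm (P₀ + (2 * Real.pi) • EuclideanSpace.single j (1 : ℝ) - c) - L.symm (P₀ - c) =
        (2 * Real.pi) • L.symm (EuclideanSpace.single j (1 : ℝ)) := by
      rw [← map_sub, ← map_smul]
      congr 1
      abel
    have e0 := congrArg (fun w : EuclideanSpace ℝ (Fin 3) => w 0) hd
    have e1 := congrArg (fun w : EuclideanSpace ℝ (Fin 3) => w 1) hd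
    simp only [PiLp.sub_apply, PiLp.smul_apply, smul_eq_mul, hj0, hj1, h00, h01, sub_zero] at e0 e1
    have hπ : (2 * Real.pi) ≠ 0 := by positivity
    exact ⟨by rcases mul_eq_zero.1 e0.symm with h | h <;> [exact absurd h hπ; exact h],
      by rcases mul_eq_zero.1 e1.symm with h | h <;> [exact absurd h hπ; exact h]⟩
  obtain ⟨hf00, hf01⟩ := hvert 0 h10 h11
  obtain ⟨hf10, hf11⟩ := hvert 1 h20 h21
  -- ## contradiction with orthonormality of `L⁻¹ e₀`, `L⁻¹ e₁`
  have hinner : ⟪L.symm (EuclideanSpace.single (0 : Fin 3) (1 : ℝ)), L.symm (EuclideanSpace.single (1 : Fin 3) (1 :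
      ℝ))⟫_ℝ = 0 := by
    rw [LinearIsometryEquiv.inner_map_map, EuclideanSpace.inner_single_left]
    simp
  have hn0 : ‖L.symm (EuclideanSpace.single (0 : Fin 3) (1 : ℝ))‖ ^ 2 = 1 := by
    rw [LinearIsometryEquiv.norm_map]; simp
  have hn1 : ‖L.symm (EuclideanSpace.single (1 : Fin 3) (1 : ℝ))‖ ^ 2 = 1 := by
    rw [LinearIsometryEquiv.norm_map]; simp
  rw [Literature.Algebra.EuclideanLattices.inner_fin_three, hf00, hf01] at hinner
  rw [Literature.Algebra.EuclideanLattices.norm_sq_fin_three, hf00, hf01] at hn0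
  rw [Literature.Algebra.EuclideanLattices.norm_sq_fin_three, hf10, hf11] at hn1
  simp only [zero_mul, zero_add, ne_eq, OfNat.ofNat_ne_zero, not_false_eq_true, zero_pow] at hinner hn0 hn1
  rcases mul_eq_zero.1 hinner with h | h
  · rw [h] at hn0; norm_num at hn0
  · rw [h] at hn1; norm_num at hn1

/-! ### The maximum set of `|T|²` -/

/-- `|T|² = 8(a² + b² + c² − ab + ac)` with `a = cos u`, `b = cos w`, `c = cos p`. [folklore] -/
theorem norm_sq_triField (x : EuclideanSpace ℝ (Fin 3)) :
    ‖triField x‖ ^ 2 = 8 * (Real.cos (x 0 + x 2) ^ 2 + Real.cos (x 1 - x 2) ^ 2 + Real.cos (x 1 + x 2) ^ 2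
      - Real.cos (x 0 + x 2) * Real.cos (x 1 - x 2) + Real.cos (x 0 + x 2) * Real.cos (x 1 + x 2)) := by
  rw [Literature.Algebra.EuclideanLattices.norm_sq_fin_three, triField_apply_zero, triField_apply_one,
    triField_apply_two]
  ring

/-- `|T|² ≤ 40` (`5 − (a²+b²+c²−ab+ac) = 2(1−a²) + (3/2)(1−b²) + (3/2)(1−c²) + (a+b)²/2 + (a−c)²/2`). [folklore] -/
theorem norm_sq_triField_le (x : EuclideanSpace ℝ (Fin 3)) : ‖triField x‖ ^ 2 ≤ 40 := by
  rw [norm_sq_triField]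
  nlinarith [Real.cos_sq_le_one (x 0 + x 2), Real.cos_sq_le_one (x 1 - x 2), Real.cos_sq_le_one (x 1 + x 2),
    sq_nonneg (Real.cos (x 0 + x 2) + Real.cos (x 1 - x 2)), sq_nonneg (Real.cos (x 0 + x 2) - Real.cos (x 1 + x 2))]

/-- On the maximum set `sin u = sin w = sin p = 0`. [folklore] -/
theorem sin_eq_zero_of_norm_sq_triField_eq {x : EuclideanSpace ℝ (Fin 3)} (h : ‖triField x‖ ^ 2 = 40) :
    Real.sin (x 0 + x 2) = 0 ∧ Real.sin (x 1 - x 2) = 0 ∧ Real.sin (x 1 + x 2) = 0 := by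
  rw [norm_sq_triField] at h
  have hu := Real.sin_sq_add_cos_sq (x 0 + x 2)
  have hw := Real.sin_sq_add_cos_sq (x 1 - x 2)
  have hp := Real.sin_sq_add_cos_sq (x 1 + x 2)
  have k1 := sq_nonneg (Real.cos (x 0 + x 2) + Real.cos (x 1 - x 2))
  have k2 := sq_nonneg (Real.cos (x 0 + x 2) - Real.cos (x 1 + x 2))
  have su := sq_nonneg (Real.sin (x 0 + x 2))
  have sw := sq_nonneg (Real.sin (x 1 - x 2))
  have sp := sq_nonneg (Real.sin (x 1 + x 2))
  refine ⟨?_, ?_, ?_⟩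
  · exact pow_eq_zero_iff (n := 2) (by norm_num) |>.1 (by nlinarith)
  · exact pow_eq_zero_iff (n := 2) (by norm_num) |>.1 (by nlinarith)
  · exact pow_eq_zero_iff (n := 2) (by norm_num) |>.1 (by nlinarith)

/-- Two zeros of `sin` at distance `< π` coincide. [folklore] -/
theorem eq_of_sin_eq_zero_of_abs_sub_lt {a b : ℝ} (ha : Real.sin a = 0) (hb : Real.sin b = 0)
    (h : |a - b| < Real.pi) : a = b := by
  obtain ⟨k, hk⟩ := Real.sin_eq_zero_iff.1 ha
  obtain ⟨m, hm⟩ := Real.sin_eq_zero_iff.1 hb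
  have hsub : a - b = (k - m : ℤ) * Real.pi := by rw [← hk, ← hm]; push_cast; ring
  have habs : |((k - m : ℤ) : ℝ)| < 1 := by
    rw [hsub, abs_mul, abs_of_pos Real.pi_pos] at h
    by_contra hge
    push Not at hge
    have := mul_le_mul_of_nonneg_right hge Real.pi_pos.le
    linarith
  have hkm : k - m = 0 := by
    have h1 : |(k - m : ℤ)| < 1 := by exact_mod_cast habs
    have h2 := abs_lt.1 h1
    omega
  have : a - b = 0 := by rw [hsub, hkm]; simp
  linarith

/-- The maximum set of `|T|²` is separated: two maximum points at distance `< 1` coincide. [folklore] -/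
theorem eq_of_norm_sq_triField_eq {x P : EuclideanSpace ℝ (Fin 3)} (hx : ‖triField x‖ ^ 2 = 40) (hP : ‖triField P‖ ^
    2 = 40)
    (hd : dist x P < 1) : x = P := by
  obtain ⟨hx0, hx1, hx2⟩ := sin_eq_zero_of_norm_sq_triField_eq hx
  obtain ⟨hP0, hP1, hP2⟩ := sin_eq_zero_of_norm_sq_triField_eq hP
  have hcoord : ∀ i : Fin 3, |x i - P i| < 1 := by
    intro i
    have h1 : |x i - P i| ≤ dist x P := by
      rw [← Real.dist_eq]
      exact PiLp.dist_apply_le x P i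
    linarith
  have a0 := abs_lt.1 (hcoord 0)
  have a1 := abs_lt.1 (hcoord 1)
  have a2 := abs_lt.1 (hcoord 2)
  have hu : x 0 + x 2 = P 0 + P 2 :=
    eq_of_sin_eq_zero_of_abs_sub_lt hx0 hP0 (by rw [abs_lt]; constructor <;> linarith [Real.pi_gt_three])
  have hw : x 1 - x 2 = P 1 - P 2 :=
    eq_of_sin_eq_zero_of_abs_sub_lt hx1 hP1 (by rw [abs_lt]; constructor <;> linarith [Real.pi_gt_three])
  have hp : x 1 + x 2 = P 1 + P 2 :=
    eq_of_sin_eq_zero_of_abs_sub_lt hx2 hP2 (by rw [abs_lt]; constructor <;> linarith [Real.pi_gt_three])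
  ext i
  fin_cases i
  · show x 0 = P 0
    linarith
  · show x 1 = P 1
    linarith
  · show x 2 = P 2
    linarith

/-- `|T|² = 40` at the points with `cos u = cos p = −1`, `cos w = 1`. [folklore] -/
theorem norm_sq_triField_eq_of_cos {x : EuclideanSpace ℝ (Fin 3)} (h0 : Real.cos (x 0 + x 2) = -1) (h1 : Real.cos (x
    1 - x 2) = 1)
    (h2 : Real.cos (x 1 + x 2) = -1) : ‖triField x‖ ^ 2 = 40 := by
  rw [norm_sq_triField, h0, h1, h2]
  norm_num

/-- **The three-wave field is axisymmetric (with or without swirl) in NO rigid frame.** [folklore] -/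
theorem triField_not_axisymmetric_anyFrame (L : EuclideanSpace ℝ (Fin 3) ≃ₗᵢ[ℝ] EuclideanSpace ℝ (Fin 3)) (c :
    EuclideanSpace ℝ (Fin 3)) :
    ¬ IsAxisymmetric (fun z => L.symm (triField (L z + c))) := by
  set P₀ : EuclideanSpace ℝ (Fin 3) := (Real.pi / 2) • (EuclideanSpace.single (0 : Fin 3) (1 : ℝ)) + (Real.pi / 2) •
      (EuclideanSpace.single (1 : Fin 3) (1 : ℝ)) + (Real.pi / 2) • (EuclideanSpace.single (2 : Fin 3) (1 : ℝ)) with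
          hP₀
  have q0 : P₀ 0 = Real.pi / 2 := by simp [hP₀]
  have q1 : P₀ 1 = Real.pi / 2 := by simp [hP₀]
  have q2 : P₀ 2 = Real.pi / 2 := by simp [hP₀]
  have c3 : Real.cos (Real.pi / 2 + 2 * Real.pi + Real.pi / 2) = -1 := by
    rw [show Real.pi / 2 + 2 * Real.pi + Real.pi / 2 = Real.pi + 2 * Real.pi by ring, Real.cos_add_two_pi,
      Real.cos_pi]
  have c4 : Real.cos (Real.pi / 2 + 2 * Real.pi - Real.pi / 2) = 1 := by
    rw [show Real.pi / 2 + 2 * Real.pi - Real.pi / 2 = 2 * Real.pi by ring, Real.cos_two_pi]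
  refine not_axisymmetric_anyFrame_of_separated_level (V := triField) (M := 40) (P₀ := P₀)
    (fun x Q hx hQ hd => eq_of_norm_sq_triField_eq hx hQ hd) ?_ ?_ ?_ L c
  · apply norm_sq_triField_eq_of_cos
    · rw [q0, q2, add_halves, Real.cos_pi]
    · rw [q1, q2, sub_self, Real.cos_zero]
    · rw [q1, q2, add_halves, Real.cos_pi]
  · have r0 : (P₀ + (2 * Real.pi) • (EuclideanSpace.single (0 : Fin 3) (1 : ℝ)) : EuclideanSpace ℝ (Fin 3)) 0 =
      Real.pi / 2 + 2 * Real.pi := by simp [hP₀]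
    have r1 : (P₀ + (2 * Real.pi) • (EuclideanSpace.single (0 : Fin 3) (1 : ℝ)) : EuclideanSpace ℝ (Fin 3)) 1 =
        Real.pi / 2 := by simp [hP₀]
    have r2 : (P₀ + (2 * Real.pi) • (EuclideanSpace.single (0 : Fin 3) (1 : ℝ)) : EuclideanSpace ℝ (Fin 3)) 2 =
        Real.pi / 2 := by simp [hP₀]
    apply norm_sq_triField_eq_of_cos
    · rw [r0, r2, c3]
    · rw [r1, r2, sub_self, Real.cos_zero]
    · rw [r1, r2, add_halves, Real.cos_pi]
  · have r0 : (P₀ + (2 * Real.pi) • (EuclideanSpace.single (1 : Fin 3) (1 : ℝ)) : EuclideanSpace ℝ (Fin 3)) 0 =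
      Real.pi / 2 := by simp [hP₀]
    have r1 : (P₀ + (2 * Real.pi) • (EuclideanSpace.single (1 : Fin 3) (1 : ℝ)) : EuclideanSpace ℝ (Fin 3)) 1 =
        Real.pi / 2 + 2 * Real.pi := by simp [hP₀]
    have r2 : (P₀ + (2 * Real.pi) • (EuclideanSpace.single (1 : Fin 3) (1 : ℝ)) : EuclideanSpace ℝ (Fin 3)) 2 =
        Real.pi / 2 := by simp [hP₀]
    apply norm_sq_triField_eq_of_cos
    · rw [r0, r2, add_halves, Real.cos_pi]
    · rw [r1, r2, c4]
    · rw [r1, r2, c3]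

/-- **No slice of the three-wave profile is axisymmetric in any rigid frame** (the any-frame clause of the residue
stub S2⁗). [folklore] -/
theorem triProfile_not_axisymmetric_anyFrame {s : ℝ} (hs : s < 0) (L : EuclideanSpace ℝ (Fin 3) ≃ₗᵢ[ℝ] EuclideanSpace
    ℝ (Fin 3)) (c : EuclideanSpace ℝ (Fin 3)) :
    ¬ IsAxisymmetric (fun y => L.symm (triProfile s (L y + c))) := by
  intro hax
  have ha := (cellAmp_pos hs).ne'
  apply triField_not_axisymmetric_anyFrame L (cellAmp s • c + Real.log (-s) • (EuclideanSpace.single (1 : Fin 3) (1 :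
      ℝ)))
  intro θ z
  have key : ∀ y : EuclideanSpace ℝ (Fin 3), L.symm (triProfile s (L y + c)) =
      cellAmp s • L.symm (triField (L (cellAmp s • y) + (cellAmp s • c + Real.log (-s) • (EuclideanSpace.single (1 :
          Fin 3) (1 : ℝ))))) := by
    intro y
    simp only [triProfile, driftShift, map_smul, smul_add, add_assoc]
  have h : L.symm (triProfile s (L (rotZ θ ((cellAmp s)⁻¹ • z)) + c)) =
      rotZ θ (L.symm (triProfile s (L ((cellAmp s)⁻¹ • z) + c))) := hax θ ((cellAmp s)⁻¹ • z)
  have hz1 : cellAmp s • rotZ θ ((cellAmp s)⁻¹ • z) = rotZ θ z := by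
    rw [← rotZ_smul, smul_smul, mul_inv_cancel₀ ha, one_smul]
  have hz2 : cellAmp s • ((cellAmp s)⁻¹ • z) = z := by rw [smul_smul, mul_inv_cancel₀ ha, one_smul]
  rw [key, key, hz1, hz2, rotZ_smul] at h
  exact smul_right_injective _ ha h

end Summit.NavierStokesRegularity.NavierStokesRegularity.Theorems.PoloidalWindowRigidity.Negative

end
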